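import Summits.QuantumFields.BalabanUV.Beta.GAN24.MultilinearProlongation
import Summits.QuantumFields.BalabanUV.Beta.GAN24.MonotoneTorusTower

/-!
# Beta / GAN24 / CochainProlongation — THE CUBICAL COCHAIN (Whitney-type) PROLONGATION OF 1-FORMS to the `R`-times finer torus: each component is
# interpolated multilinearly in the TRANSVERSAL directions and kept constant along its own direction inside a cell, so that the fine plaquettes of
# `Pco A` are `R⁻¹ ×` the transversal multilinear interpolation of the coarse plaquettes (`dP₁ = P₂d`), whence THE EXACT CURL-ENERGY INEQUALITY
# `curlEnergy (Pco A) ≤ (R^d/R²)·curlEnergy A` — step S2 of candidate route R1 of `HOME/beta/ROUTES-GAN24.md` v1 for 1-FORMS (the objects of road P4's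
# torus avatar), every `d`, every torus, hypothesis-free (binder row G-an2-4 ∕ (CONV-C); road P2 seat gan24-p2 gen 28; NOT IN PRINT — our proof attempt)

HONEST FRAMING (page 1 of everything the β sub-cell writes): discharging `BetaPertH` makes Bałaban's UV stability UNCONDITIONAL — a
real constructive-QFT result; it is NOT the continuum limit and NOT the Clay problem.  HONEST DEPENDENCY (cell reorg 2026-08-19, verbatim):
«continuum YM on T⁴ ⇐ BetaPertH ∧ nine spine estimates (0/9 proved); BetaPertH ⇐ (D1) ∧ (D4) ∧ CAP+tail; G-an2-4 gates asym, D1 and NE2/3/4.»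
HONEST LABEL: «not in print; our proof attempt»; 0 wall binders instantiated; NEVER «G-an2-4 closed».

ABSOLUTE RULE (cell charter, verbatim): "No internally-minted statement may enter as a cited fact. Every hypothesis is either
kernel-proved in this package or a verbatim quotation of a PUBLISHED theorem with page reference. The manuscript(s) under audit are
NOT citable for their own disputed steps — they are the thing under adjudication; programme-internal (2001/route/tribunal) claims
are never citable."  Nothing is cited; [folklore] finite lattice calculus over `GAN24/MultilinearProlongation` (`icore`, `vwt`, `twR`, the tensor recursion,
convexity, tile sums) and the tree's `plaq`∕`curlEnergy` (`B5AverageCurlStokes`, `MonotoneTorusTower`) BY NAME; no `def … : Prop`.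

## WHAT IS PROVED (0 sorry; coarse torus `Tor (fine N M)`, fine torus `Tor (fine (R·N) M)`, every `d`, `N, R ≥ 1`)
* §1 `icT s u x := icore s u (par x) (twR x)` and its two step formulas: **`icT_step_mem`** (`μ ∈ s`: `icT s u (x+e′_μ) − icT s u x = R⁻¹·icT (s∖{μ}) (∇_μu) x`,
  in-cell and cell-crossing alike) and **`icT_step_not_mem`** (`μ ∉ s`: `= [x on the far μ-face]·icT s (∇_μu) x` — constant along the cell, a jump at the face);
  the tiled majorant sum `sum_tile_majorant` (`Σ_{x′}Σ_{T⊆s} vwt·|g(par x′ + vtx T)|² = R^d·Σ_y|g y|²`, any `s`).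
* §2 **`Pco A (x′,ν) := icT (univ∖{ν}) (A(·,ν)) x′`** and **`plaq_Pco`**: `plaq′ (Pco A) μ ν x′ = R⁻¹·icT (univ∖{μ,ν}) (plaq A μ ν) x′` (`dP₁ = P₂d` at the
  cochain level: the fine plaquette is the transversally interpolated coarse plaquette spread over the `R²` fine plaquettes of the coarse one).
* §3 **`sum_norm_sq_plaq_Pco_le`** (per plaquette orientation) and **`curlEnergy_Pco_le : curlEnergy (Pco A) ≤ (R^d/R²)·curlEnergy A`** — with road P4's
  `hform k = (Lc²/Lc^d)^k • curlMatᴴcurlMat` and `R = Lc^m` this is exactly `re⟨Pco A, hform (k+m) (Pco A)⟩ ≤ re⟨A, hform k A⟩`: hypothesis (PROL) of `GAN24/MonotoneSqueeze`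
  for road P4's torus avatar; **`Pco_const`** (constant 1-forms are reproduced).
WHAT THIS IS NOT: the row defect of `Pco` against Bałaban's line-sum rows (1.18) (R1-S3), the H² input (S4), the instantiation of `MonotoneSqueeze.squeeze_nsq` — open route
work; numerically all confirmed ((P-R1c), kit j121501: S2 exact to 4·10⁻¹⁴, rates `Lc^{−2j}`); NOT (CONV-C), NOT D1, NOT BetaPertH, NOT continuum, NOT Clay.
-/

noncomputable section

namespace Summit.QuantumFields.BalabanUV.Beta.GAN24.CochainProlongation

open Finset
open scoped BigOperators
open Literature.MathematicalPhysics.QuantumFieldTheory.Balaban1983to89.B5Prop11Plancherel (Tor fine unitVec)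
open Literature.MathematicalPhysics.QuantumFieldTheory.Balaban1983to89.B5AverageCurlStokes (plaq plaq_apply)
open Literature.MathematicalPhysics.QuantumFieldTheory.Balaban1983to89.B5G183RateTorus (cpt)
open Literature.MathematicalPhysics.QuantumFieldTheory.Balaban1983to89.B5G183RateTorusW (off)
open Summit.QuantumFields.BalabanUV.T4Continuum.BalabanAveragedTowerModes (par rem par_cpt_add_off rem_cpt_add_off)
open Summit.QuantumFields.BalabanUV.T4Continuum.BlockPairingGeometry (par_add_unitVec)
open Summit.QuantumFields.BalabanUV.T4Continuum.CellTaylorPlanting (sum_fine_eq_sum_tile_real)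
open Summit.QuantumFields.BalabanUV.Beta.GAN24.MonotoneTorusTower (curlEnergy)
open Summit.QuantumFields.BalabanUV.Beta.GAN24.MultilinearProlongation (vtx vwt sum_vwt icore icore_congr_w icore_sub icore_shift icore_insert
  norm_icore_sq_le twR twR_nonneg twR_le_one twR_add_unitVec_of_ne twR_face twR_not_face twR_tile sum_shift_eq)

variable {d : ℕ} (N R : ℕ) [NeZero N] [NeZero R] (M : Fin d → ℕ) [hM : ∀ μ, NeZero (M μ)]

/-! ## §1 Interpolation in a set of directions, read at a fine site; the two step formulas; the tiled majorant -/

/-- `icT s u x := icore s u (par x) (twR x)` — `u` interpolated multilinearly in the directions `s` inside the cell of `x`, piecewise constant in the others. [folklore] -/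
def icT (s : Finset (Fin d)) (u : Tor (fine N M) → ℂ) (x : Tor (fine (R * N) M)) : ℂ := icore (fine N M) s u (par N R M x) (twR N R M x)

/-- the coarse forward difference `∇_μ u (y) = u(y + e_μ) − u y`. [folklore] -/
def cfd (μ : Fin d) (u : Tor (fine N M) → ℂ) : Tor (fine N M) → ℂ := fun y => u (y + unitVec (fine N M) μ) - u y

omit [NeZero N] hM in
/-- linearity of `icT` in the field. [folklore] -/
theorem icT_sub (s : Finset (Fin d)) (u v : Tor (fine N M) → ℂ) (x : Tor (fine (R * N) M)) :
    icT N R M s (fun y => u y - v y) x = icT N R M s u x - icT N R M s v x := icore_sub _ _ _ _ _ _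

/-- **STEP IN AN INTERPOLATED DIRECTION** (`μ ∈ s`): `icT s u (x + e′_μ) − icT s u x = R⁻¹·icT (s∖{μ}) (∇_μ u) x`. [folklore] -/
theorem icT_step_mem {s : Finset (Fin d)} {μ : Fin d} (hμ : μ ∈ s) (u : Tor (fine N M) → ℂ) (x : Tor (fine (R * N) M)) :
    icT N R M s u (x + unitVec (fine (R * N) M) μ) - icT N R M s u x = ((1 / R : ℝ) : ℂ) * icT N R M (s.erase μ) (cfd N M μ u) x := by
  set t := s.erase μ with ht
  set z := par N R M x with hz
  set e := unitVec (fine N M) μ with he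
  have hst : s = insert μ t := (insert_erase hμ).symm
  have hμt : μ ∉ t := notMem_erase μ s
  have hw : ∀ ν ∈ t, twR N R M (x + unitVec (fine (R * N) M) μ) ν = twR N R M x ν :=
    fun ν hν => twR_add_unitVec_of_ne N R M (ne_of_mem_erase hν) x
  have hI : ∀ z', icore (fine N M) t u z' (twR N R M (x + unitVec (fine (R * N) M) μ)) = icore (fine N M) t u z' (twR N R M x) :=
    fun z' => icore_congr_w (fine N M) t u z' hw
  have hdiff : icore (fine N M) t u (z + e) (twR N R M x) - icore (fine N M) t u z (twR N R M x)
      = icore (fine N M) t (cfd N M μ u) z (twR N R M x) := by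
    rw [icore_shift, ← icore_sub]; rfl
  unfold icT
  rw [hst, icore_insert (fine N M) hμt, icore_insert (fine N M) hμt, hI, hI, par_add_unitVec]
  by_cases hf : R ∣ (x μ).val + 1
  · obtain ⟨h1, h2⟩ := twR_face N R M hf
    rw [if_pos hf, h1, h2, ← hz, ← he, ← hdiff]
    have hR : (R : ℂ) ≠ 0 := by exact_mod_cast NeZero.ne R
    push_cast
    field_simp
    ring
  · rw [if_neg hf, twR_not_face N R M hf, ← hz, ← he, ← hdiff]
    push_cast
    ring

/-- **STEP IN A NON-INTERPOLATED DIRECTION** (`μ ∉ s`): `icT s u (x + e′_μ) − icT s u x = [far μ-face]·icT s (∇_μ u) x` — the interpolant is constant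
along `μ` inside the cell and jumps across the face. [folklore] -/
theorem icT_step_not_mem {s : Finset (Fin d)} {μ : Fin d} (hμ : μ ∉ s) (u : Tor (fine N M) → ℂ) (x : Tor (fine (R * N) M)) :
    icT N R M s u (x + unitVec (fine (R * N) M) μ) - icT N R M s u x
      = (if R ∣ (x μ).val + 1 then 1 else 0) * icT N R M s (cfd N M μ u) x := by
  have hw : ∀ ν ∈ s, twR N R M (x + unitVec (fine (R * N) M) μ) ν = twR N R M x ν :=
    fun ν hν => twR_add_unitVec_of_ne N R M (ne_of_mem_of_not_mem hν hμ) x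
  unfold icT
  rw [icore_congr_w (fine N M) s u _ hw, par_add_unitVec]
  by_cases hf : R ∣ (x μ).val + 1
  · rw [if_pos hf, if_pos hf, one_mul, icore_shift, ← icore_sub]; rfl
  · rw [if_neg hf, if_neg hf, sub_self, zero_mul]

/-- **THE TILED MAJORANT SUM**: `Σ_{x′} Σ_{T⊆s} vwt s T (twR x′)·|g(par x′ + vtx T)|² = R^d·Σ_y |g y|²` for every direction set `s`
(tile `x′ = cpt y + off j`, translation invariance of `Σ_y`, `Σ_T vwt = 1`). [folklore] -/
theorem sum_tile_majorant (s : Finset (Fin d)) (g : Tor (fine N M) → ℂ) :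
    ∑ x : Tor (fine (R * N) M), ∑ T ∈ s.powerset, vwt s T (twR N R M x) * ‖g (par N R M x + vtx (fine N M) T)‖ ^ 2
      = (R : ℝ) ^ d * ∑ y : Tor (fine N M), ‖g y‖ ^ 2 := by
  set G : ℝ := ∑ y : Tor (fine N M), ‖g y‖ ^ 2 with hG
  rw [sum_fine_eq_sum_tile_real N R M]
  simp_rw [par_cpt_add_off, twR_tile]
  rw [sum_comm]
  have hinner : ∀ j : Fin d → Fin R, ∑ y : Tor (fine N M), ∑ T ∈ s.powerset,
      vwt s T (fun ν => ((j ν : ℕ) : ℝ) / R) * ‖g (y + vtx (fine N M) T)‖ ^ 2 = G := by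
    intro j
    rw [sum_comm]
    calc ∑ T ∈ s.powerset, ∑ y : Tor (fine N M), vwt s T (fun ν => ((j ν : ℕ) : ℝ) / R) * ‖g (y + vtx (fine N M) T)‖ ^ 2
        = ∑ T ∈ s.powerset, vwt s T (fun ν => ((j ν : ℕ) : ℝ) / R) * G := by
          refine sum_congr rfl fun T _ => ?_
          rw [← mul_sum, show ∑ i : Tor (fine N M), ‖g (i + vtx (fine N M) T)‖ ^ 2 = G from sum_shift_eq N M (fun y => ‖g y‖ ^ 2) _]
      _ = G := by rw [← sum_mul, sum_vwt, one_mul]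
  simp_rw [hinner]
  rw [sum_const, card_univ, Fintype.card_fun, Fintype.card_fin, Fintype.card_fin, nsmul_eq_mul]
  push_cast
  ring

/-- **THE ENERGY OF ONE INTERPOLATED DIFFERENCE**: `Σ_{x′} |R⁻¹·icT s g x′|² ≤ (R^d/R²)·Σ_y |g y|²`. [folklore] -/
theorem sum_norm_sq_icT_le (s : Finset (Fin d)) (g : Tor (fine N M) → ℂ) :
    ∑ x : Tor (fine (R * N) M), ‖((1 / R : ℝ) : ℂ) * icT N R M s g x‖ ^ 2 ≤ (R : ℝ) ^ d / (R : ℝ) ^ 2 * ∑ y : Tor (fine N M), ‖g y‖ ^ 2 := by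
  have hR : (0 : ℝ) < R := Nat.cast_pos.mpr (Nat.pos_of_ne_zero (NeZero.ne R))
  have hpt : ∀ x : Tor (fine (R * N) M), ‖((1 / R : ℝ) : ℂ) * icT N R M s g x‖ ^ 2
      ≤ (1 / R) ^ 2 * ∑ T ∈ s.powerset, vwt s T (twR N R M x) * ‖g (par N R M x + vtx (fine N M) T)‖ ^ 2 := by
    intro x
    rw [norm_mul, mul_pow, Complex.norm_real, Real.norm_of_nonneg (by positivity)]
    exact mul_le_mul_of_nonneg_left
      (norm_icore_sq_le (fine N M) (fun ν _ => twR_nonneg N R M x ν) (fun ν _ => twR_le_one N R M x ν) g (par N R M x)) (by positivity)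
  calc ∑ x : Tor (fine (R * N) M), ‖((1 / R : ℝ) : ℂ) * icT N R M s g x‖ ^ 2
      ≤ ∑ x : Tor (fine (R * N) M), (1 / R) ^ 2 * ∑ T ∈ s.powerset, vwt s T (twR N R M x) * ‖g (par N R M x + vtx (fine N M) T)‖ ^ 2 :=
        sum_le_sum fun x _ => hpt x
    _ = (1 / R) ^ 2 * ((R : ℝ) ^ d * ∑ y : Tor (fine N M), ‖g y‖ ^ 2) := by rw [← mul_sum, sum_tile_majorant]
    _ = (R : ℝ) ^ d / (R : ℝ) ^ 2 * ∑ y : Tor (fine N M), ‖g y‖ ^ 2 := by field_simp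

/-! ## §2 The cochain prolongation of 1-forms and its plaquettes -/

/-- **THE COCHAIN PROLONGATION** of a 1-form: `(Pco A)(x′, ν) := icT (univ ∖ {ν}) (A(·,ν)) x′` — the component `ν` interpolated multilinearly in the
directions `≠ ν` and constant along `ν` inside each cell (the cubical Whitney 1-form of the coarse cochain, per unit length). [folklore] -/
def Pco (A : Tor (fine N M) × Fin d → ℂ) (i : Tor (fine (R * N) M) × Fin d) : ℂ := icT N R M (univ.erase i.2) (fun y => A (y, i.2)) i.1

omit [NeZero N] hM in
/-- the coarse plaquette is the antisymmetrised pair of forward differences: `plaq A μ ν = ∇_μ A_ν − ∇_ν A_μ`. [folklore] -/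
theorem plaq_eq_cfd (A : Tor (fine N M) × Fin d → ℂ) (μ ν : Fin d) (y : Tor (fine N M)) :
    plaq (fine N M) A μ ν y = cfd N M μ (fun y => A (y, ν)) y - cfd N M ν (fun y => A (y, μ)) y := by
  rw [plaq_apply, cfd, cfd]; ring

/-- **`dP₁ = P₂d` AT THE COCHAIN LEVEL**: for `μ ≠ ν`, `plaq′ (Pco A) μ ν x′ = R⁻¹·icT (univ ∖ {μ, ν}) (plaq A μ ν) x′` — the fine plaquette of the prolongation
is the transversally interpolated coarse plaquette, divided by `R` (per unit length; `R²` fine plaquettes per coarse one, area `R⁻²` each). [folklore] -/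
theorem plaq_Pco {μ ν : Fin d} (hμν : μ ≠ ν) (A : Tor (fine N M) × Fin d → ℂ) (x : Tor (fine (R * N) M)) :
    plaq (fine (R * N) M) (Pco N R M A) μ ν x
      = ((1 / R : ℝ) : ℂ) * icT N R M ((univ.erase ν).erase μ) (plaq (fine N M) A μ ν) x := by
  have h1 : Pco N R M A (x + unitVec (fine (R * N) M) μ, ν) - Pco N R M A (x, ν)
      = ((1 / R : ℝ) : ℂ) * icT N R M ((univ.erase ν).erase μ) (cfd N M μ fun y => A (y, ν)) x := by
    unfold Pco
    exact icT_step_mem N R M (mem_erase.mpr ⟨hμν, mem_univ μ⟩) _ x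
  have h2 : Pco N R M A (x + unitVec (fine (R * N) M) ν, μ) - Pco N R M A (x, μ)
      = ((1 / R : ℝ) : ℂ) * icT N R M ((univ.erase ν).erase μ) (cfd N M ν fun y => A (y, μ)) x := by
    unfold Pco
    rw [erase_right_comm]
    exact icT_step_mem N R M (mem_erase.mpr ⟨Ne.symm hμν, mem_univ ν⟩) _ x
  have e : plaq (fine (R * N) M) (Pco N R M A) μ ν x
      = (Pco N R M A (x + unitVec (fine (R * N) M) μ, ν) - Pco N R M A (x, ν))
        - (Pco N R M A (x + unitVec (fine (R * N) M) ν, μ) - Pco N R M A (x, μ)) := by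
    rw [plaq_apply]; ring
  rw [e, h1, h2, ← mul_sub, ← icT_sub]
  congr 1
  refine congrArg (fun f => icT N R M ((univ.erase ν).erase μ) f x) (funext fun y => ?_)
  rw [plaq_eq_cfd]

/-! ## §3 The curl-energy inequality -/

/-- **PER ORIENTATION**: `Σ_{x′} |plaq′ (Pco A) μ ν x′|² ≤ (R^d/R²)·Σ_y |plaq A μ ν y|²`. [folklore] -/
theorem sum_norm_sq_plaq_Pco_le (μ ν : Fin d) (A : Tor (fine N M) × Fin d → ℂ) :
    ∑ x : Tor (fine (R * N) M), ‖plaq (fine (R * N) M) (Pco N R M A) μ ν x‖ ^ 2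
      ≤ (R : ℝ) ^ d / (R : ℝ) ^ 2 * ∑ y : Tor (fine N M), ‖plaq (fine N M) A μ ν y‖ ^ 2 := by
  by_cases hμν : μ = ν
  · subst hμν
    have h0 : ∀ (K : Fin d → ℕ) [∀ i, NeZero (K i)] (B : Tor K × Fin d → ℂ) (y : Tor K), plaq K B μ μ y = 0 := by
      intro K _ B y; rw [plaq_apply]; ring
    simp_rw [h0, norm_zero]
    simp
  · simp_rw [plaq_Pco N R M hμν]
    exact sum_norm_sq_icT_le N R M _ _

/-- **THE CURL-ENERGY INEQUALITY**: `curlEnergy (Pco A) ≤ (R^d/R²)·curlEnergy A` — the cochain prolongation does NOT raise the (lattice-unit) curl energy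
beyond the factor `R^{d−2}`; with the Wilson normalisation `η^{d−2}` per level (`MonotoneTorusTower.hform`) this is `S_{η/R}(Pco A) ≤ S_η(A)`: hypothesis (PROL) of
`GAN24/MonotoneSqueeze` for road P4's torus avatar. [folklore] -/
theorem curlEnergy_Pco_le (A : Tor (fine N M) × Fin d → ℂ) :
    curlEnergy (fine (R * N) M) (Pco N R M A) ≤ (R : ℝ) ^ d / (R : ℝ) ^ 2 * curlEnergy (fine N M) A := by
  unfold curlEnergy
  rw [mul_sum]
  refine sum_le_sum fun μ _ => ?_
  rw [mul_sum]
  exact sum_le_sum fun ν _ => sum_norm_sq_plaq_Pco_le N R M μ ν A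

omit [NeZero N] hM in
/-- **CONSTANT 1-FORMS ARE REPRODUCED**: `Pco (fun (·, ν) => c ν) (x′, ν) = c ν`. [folklore] -/
theorem Pco_const (c : Fin d → ℂ) (i : Tor (fine (R * N) M) × Fin d) : Pco N R M (fun p => c p.2) i = c i.2 := by
  unfold Pco icT icore
  have h := sum_vwt (univ.erase i.2) (twR N R M i.1)
  have h' : ∑ T ∈ (univ.erase i.2).powerset, (vwt (univ.erase i.2) T (twR N R M i.1) : ℂ) = 1 := by exact_mod_cast h
  calc ∑ T ∈ (univ.erase i.2).powerset, (vwt (univ.erase i.2) T (twR N R M i.1) : ℂ) * (fun y => (fun p : Tor (fine N M) × Fin d => c p.2) (y, i.2))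
          (par N R M i.1 + vtx (fine N M) T)
      = ∑ T ∈ (univ.erase i.2).powerset, (vwt (univ.erase i.2) T (twR N R M i.1) : ℂ) * c i.2 := sum_congr rfl fun T _ => rfl
    _ = c i.2 := by rw [← sum_mul, h', one_mul]

end Summit.QuantumFields.BalabanUV.Beta.GAN24.CochainProlongation
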